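import Literature.Probability.Percolation.SitePaths
import HarnessLib

/-!
# Crux `NestingRigidity`, line `pinch-resampling` (v4), stub S11: bridges of an augmented graph — generic form of the `𝔄`-structure

Crux `Summit.CriticalPhenomena.CardyFormulaZ2.Theses.CardyMagicRigidity.NestingRigidity` (stmt-CriticalPhenomena-4835),
line `pinch-resampling` v4, stub S11 `stub_neckHookupCoarseT : NeckHookupCoarseT` (and S12).  Worker W6c, wave 6.

The `𝔄`-error of the fuzzy hook-up (`THookStar ∖ THook` on `𝕋`, `ZHookStar ∖ ZHookR` on `ℤ²`) is a chain of real open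
edges of the big ball `O` and VIRTUAL edges (a set `F` of ordered pairs) between two crossings `b, b'` that are NOT joined
by a real open path of `O`.  Its intrinsic structure — for a family `F` every edge of which is NEEDED, the `b`-sides
`S_e = {v | b ⟶ v over F ∖ {e}}` are nested, and no real open cluster of `O` contains the locales of three distinct edges —
was proved for bond `ℤ²` in `…NeckZ2CoveringAClusters` (worker W1, p164864) against the concrete step set
`NeckCoarseZ2.zAugSteps s x ω F`.  This module re-proves it ONCE for an arbitrary simple graph `H` on a type `V` and an
arbitrary region `O : Set V` (`NeckBridge.bAugSteps H O F`); the `𝕋` step set `augSteps s x η F` of `…NeckCoveringA` and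
the `ℤ²` step set are definitionally `bAugSteps (tColourGraph η true) (tBall x (2 * s)) F` and
`bAugSteps (openGraph ω) (zBall x (2 * s)) F`.  Everything is adapted from `…NeckZ2CoveringAClusters` /
`…NeckZ2VirtualEdges` (comments `-- adapted from` omitted on each lemma: the whole file is the adaptation).

* §0 `bAugSteps`, chains: exit steps, symmetry, monotonicity, real paths are chains, real classes, last exits, bands.
* §1 Bridges: `step_eq_of_exit`, `mem_of_needed`, `ne_swap_of_needed`, `step_mem_diff_of_needed`.
* §2 Nested sides `side_subset_or_subset` and the three-edge exclusion `not_three_locales_joined`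
  (closed form `bridge_not_three_locales_joined`, registered anchor).
-/

namespace Summit.CriticalPhenomena.CardyFormulaZ2.Cruxes.NestingRigidity.PinchResampling

open Set Literature.Probability.Percolation

namespace NeckBridge

variable {V : Type*} {H : SimpleGraph V} {O : Set V}

/-! ## §0 Augmented steps and chains -/

/-- **Augmented steps** of the region `O` in the graph `H` by a set `F` of virtual edges: real `H`-edges with both
endpoints in `O`, or pairs of `F` in either orientation. -/
def bAugSteps (H : SimpleGraph V) (O : Set V) (F : Set (V × V)) : Set (V × V) :=
  {q | (H.Adj q.1 q.2 ∧ q.1 ∈ O ∧ q.2 ∈ O) ∨ q ∈ F ∨ (q.2, q.1) ∈ F}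

/-- Along an augmented chain from a point of `P` to a point outside `P` there is a step leaving `P`, preceded by a
chain from the start. -/
theorem bAugChain_exists_step_out {G : Set (V × V)} {P : Set V} {a b : V}
    (h : Relation.ReflTransGen (fun a c ↦ (a, c) ∈ bAugSteps H O G) a b) (ha : a ∈ P) (hb : b ∉ P) :
    ∃ y z, y ∈ P ∧ z ∉ P ∧ (y, z) ∈ bAugSteps H O G ∧
      Relation.ReflTransGen (fun a c ↦ (a, c) ∈ bAugSteps H O G) a y := by
  induction h with
  | refl => exact (hb ha).elim
  | @tail y z hay hyz ih =>
    by_cases hy : y ∈ P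
    · exact ⟨y, z, hy, hb, hyz, hay⟩
    · exact ih hy

/-- Augmented steps are symmetric. -/
theorem bAugSteps_symm {F : Set (V × V)} {a b : V} (h : (a, b) ∈ bAugSteps H O F) : (b, a) ∈ bAugSteps H O F := by
  rcases h with ⟨hadj, ha, hb⟩ | hF | hF
  · exact Or.inl ⟨hadj.symm, hb, ha⟩
  · exact Or.inr (Or.inr hF)
  · exact Or.inr (Or.inl hF)

/-- Augmented chains are symmetric. -/
theorem bAugChain_symm {F : Set (V × V)} {a b : V}
    (h : Relation.ReflTransGen (fun a b ↦ (a, b) ∈ bAugSteps H O F) a b) :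
    Relation.ReflTransGen (fun a b ↦ (a, b) ∈ bAugSteps H O F) b a := by
  induction h with
  | refl => exact Relation.ReflTransGen.refl
  | tail _ hyz ih =>
    exact (Relation.ReflTransGen.single (r := fun a b ↦ (a, b) ∈ bAugSteps H O F) (bAugSteps_symm hyz)).trans ih

/-- Augmented chains are monotone in the set of virtual edges. -/
theorem bAugChain_mono {F G : Set (V × V)} (hFG : F ⊆ G) {a b : V}
    (h : Relation.ReflTransGen (fun a b ↦ (a, b) ∈ bAugSteps H O F) a b) :
    Relation.ReflTransGen (fun a b ↦ (a, b) ∈ bAugSteps H O G) a b := by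
  induction h with
  | refl => exact Relation.ReflTransGen.refl
  | tail _ hab ih =>
    refine ih.tail ?_
    rcases hab with h1 | h2 | h3
    · exact Or.inl h1
    · exact Or.inr (Or.inl (hFG h2))
    · exact Or.inr (Or.inr (hFG h3))

/-- A real `H`-path inside a subset of `O` is an augmented chain (for any `F`). -/
theorem bAugChain_of_pathIn (F : Set (V × V)) {B : Set V} (hB : B ⊆ O) {a b : V} (hp : PathIn H B a b) :
    Relation.ReflTransGen (fun a b ↦ (a, b) ∈ bAugSteps H O F) a b := by
  obtain ⟨ha, p⟩ := hp
  induction p with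
  | refl => exact Relation.ReflTransGen.refl
  | @tail y z hay hyz ih =>
    have hy : y ∈ B := PathIn.right_mem (show PathIn H _ a y from ⟨ha, hay⟩)
    exact ih.tail (Or.inl ⟨hyz.1, hB hy, hB hyz.2⟩)

/-- **Real classes along an augmented chain**: a point reached from `b` by an augmented chain over `G` is joined by a
real `H`-path of `O` either to `b` or to an endpoint of a virtual edge of `G`. -/
theorem real_or_endpoint_of_bAugChain {G : Set (V × V)} (hG : ∀ e ∈ G, e.1 ∈ O ∧ e.2 ∈ O) {b z : V} (hb : b ∈ O)
    (h : Relation.ReflTransGen (fun a b ↦ (a, b) ∈ bAugSteps H O G) b z) :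
    PathIn H O b z ∨ ∃ e ∈ G, PathIn H O e.1 z ∨ PathIn H O e.2 z := by
  induction h with
  | refl => exact Or.inl (PathIn.refl hb)
  | @tail y z _ hyz ih =>
    rcases hyz with ⟨hadj, -, hzO⟩ | hF | hF
    · rcases ih with h1 | ⟨e, he, h2 | h2⟩
      · exact Or.inl (h1.tail hadj hzO)
      · exact Or.inr ⟨e, he, Or.inl (h2.tail hadj hzO)⟩
      · exact Or.inr ⟨e, he, Or.inr (h2.tail hadj hzO)⟩
    · exact Or.inr ⟨(y, z), hF, Or.inr (PathIn.refl (hG _ hF).2)⟩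
    · exact Or.inr ⟨(z, y), hF, Or.inl (PathIn.refl (hG _ hF).1)⟩

/-! ## §1 Bridges of the augmented graph -/

/-- **Exit steps are `e`-steps**: a step of the augmentation by `F` from a point chained to `b` over `F ∖ {e}` to a
point not so chained is the virtual edge `e`, in one of its two orientations. -/
theorem step_eq_of_exit {F : Set (V × V)} {e : V × V} {b y z : V}
    (hyz : (y, z) ∈ bAugSteps H O F)
    (hy : Relation.ReflTransGen (fun a c ↦ (a, c) ∈ bAugSteps H O (F \ {e})) b y)
    (hz : ¬ Relation.ReflTransGen (fun a c ↦ (a, c) ∈ bAugSteps H O (F \ {e})) b z) :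
    (y, z) = e ∨ (z, y) = e := by
  rcases hyz with hreal | hF | hF
  · exact (hz (hy.tail (Or.inl hreal))).elim
  · by_cases h : (y, z) = e
    · exact Or.inl h
    · exact (hz (hy.tail (Or.inr (Or.inl ⟨hF, h⟩)))).elim
  · by_cases h : (z, y) = e
    · exact Or.inr h
    · exact (hz (hy.tail (Or.inr (Or.inr ⟨hF, h⟩)))).elim

/-- **Real classes**: two points joined by an open path of `O` are chained to `b` over `G` simultaneously. -/
theorem bAugChain_iff_of_pathIn (G : Set (V × V)) {b u v : V}
    (h : PathIn H O u v) :
    Relation.ReflTransGen (fun a c ↦ (a, c) ∈ bAugSteps H O G) b u ↔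
      Relation.ReflTransGen (fun a c ↦ (a, c) ∈ bAugSteps H O G) b v :=
  ⟨fun hu ↦ hu.trans (bAugChain_of_pathIn G Subset.rfl h),
    fun hv ↦ hv.trans (bAugChain_of_pathIn G Subset.rfl h.symm)⟩

/-- A needed edge belongs to the family. -/
theorem mem_of_needed {F : Set (V × V)} {e : V × V} {b b' : V}
    (hconn : Relation.ReflTransGen (fun a c ↦ (a, c) ∈ bAugSteps H O F) b b')
    (he : ¬ Relation.ReflTransGen (fun a c ↦ (a, c) ∈ bAugSteps H O (F \ {e})) b b') : e ∈ F := by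
  by_contra h
  rw [sdiff_singleton_eq_self h] at he
  exact he hconn

/-- **A needed edge is not the reverse of another needed edge** (the reverse would serve in its place). -/
theorem ne_swap_of_needed {F : Set (V × V)} {e e' : V × V} {b b' : V}
    (hconn : Relation.ReflTransGen (fun a c ↦ (a, c) ∈ bAugSteps H O F) b b')
    (he : ¬ Relation.ReflTransGen (fun a c ↦ (a, c) ∈ bAugSteps H O (F \ {e})) b b')
    (he' : ¬ Relation.ReflTransGen (fun a c ↦ (a, c) ∈ bAugSteps H O (F \ {e'})) b b') (hne : e ≠ e') :
    e' ≠ (e.2, e.1) := by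
  intro hsw
  have heF : e ∈ F := mem_of_needed hconn he
  have heF' : e ∈ F \ {e'} := ⟨heF, hne⟩
  refine he' (Relation.ReflTransGen.mono (p := fun a c ↦ (a, c) ∈ bAugSteps H O (F \ {e'}))
    (fun u v (huv : (u, v) ∈ bAugSteps H O F) ↦ ?_) b b' hconn)
  rcases huv with hreal | hF | hF
  · exact Or.inl hreal
  · by_cases h : (u, v) = e'
    · refine Or.inr (Or.inr ?_)
      have huv : u = e.2 ∧ v = e.1 := by simpa only [Prod.mk.injEq] using h.trans hsw
      obtain ⟨rfl, rfl⟩ := huv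
      exact heF'
    · exact Or.inr (Or.inl ⟨hF, h⟩)
  · by_cases h : (v, u) = e'
    · refine Or.inr (Or.inl ?_)
      have huv : v = e.2 ∧ u = e.1 := by simpa only [Prod.mk.injEq] using h.trans hsw
      obtain ⟨rfl, rfl⟩ := huv
      exact heF'
    · exact Or.inr (Or.inr ⟨hF, h⟩)

/-- An `f`-step of the full augmentation is a step of the augmentation by `F ∖ {f'}`, for needed `f ≠ f'`. -/
theorem step_mem_diff_of_needed {F : Set (V × V)} {f f' : V × V} {b b' y z : V}
    (hconn : Relation.ReflTransGen (fun a c ↦ (a, c) ∈ bAugSteps H O F) b b')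
    (hf : ¬ Relation.ReflTransGen (fun a c ↦ (a, c) ∈ bAugSteps H O (F \ {f})) b b')
    (hf' : ¬ Relation.ReflTransGen (fun a c ↦ (a, c) ∈ bAugSteps H O (F \ {f'})) b b') (hne : f ≠ f')
    (hyz : (y, z) ∈ bAugSteps H O F) (hor : (y, z) = f ∨ (z, y) = f) :
    (y, z) ∈ bAugSteps H O (F \ {f'}) := by
  have hsw : f' ≠ (f.2, f.1) := ne_swap_of_needed hconn hf hf' hne
  rcases hyz with hreal | hF | hF
  · exact Or.inl hreal
  · refine Or.inr (Or.inl ⟨hF, fun h ↦ ?_⟩)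
    rcases hor with h' | h'
    · exact hne (h'.symm.trans h)
    · exact hsw (by rw [← h, ← h'])
  · refine Or.inr (Or.inr ⟨hF, fun h ↦ ?_⟩)
    rcases hor with h' | h'
    · exact hsw (by rw [← h, ← h'])
    · exact hne (h'.symm.trans h)

/-! ## §2 Nested sides and the three-edge exclusion -/

/-- **Both endpoints of a needed edge `e'` lie in the union of the `b`-sides of `e` and `e'`**, as soon as some point
is chained to `b` over `F ∖ {e}` but not over `F ∖ {e'}`. -/
theorem endpoints_mem_union {F : Set (V × V)} {e e' : V × V} {b v : V}
    (hv : Relation.ReflTransGen (fun a c ↦ (a, c) ∈ bAugSteps H O (F \ {e})) b v)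
    (hv' : ¬ Relation.ReflTransGen (fun a c ↦ (a, c) ∈ bAugSteps H O (F \ {e'})) b v) :
    ∀ p, (p = e'.1 ∨ p = e'.2) →
      Relation.ReflTransGen (fun a c ↦ (a, c) ∈ bAugSteps H O (F \ {e})) b p ∨
        Relation.ReflTransGen (fun a c ↦ (a, c) ∈ bAugSteps H O (F \ {e'})) b p := by
  -- exit from the set of points chained over `F ∖ {e} ∖ {e'}` along the chain `b ⟶ v` over `F ∖ {e}`
  have hsub : (F \ {e}) \ {e'} ⊆ F \ {e'} := fun q hq ↦ ⟨hq.1.1, hq.2⟩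
  have hvS : ¬ Relation.ReflTransGen (fun a c ↦ (a, c) ∈ bAugSteps H O ((F \ {e}) \ {e'})) b v :=
    fun h ↦ hv' (bAugChain_mono hsub h)
  obtain ⟨y, z, hy, hz, hyz, hby⟩ := bAugChain_exists_step_out
    (P := {u | Relation.ReflTransGen (fun a c ↦ (a, c) ∈ bAugSteps H O ((F \ {e}) \ {e'})) b u}) hv
    Relation.ReflTransGen.refl hvS
  simp only [mem_setOf_eq] at hy hz
  have hor : (y, z) = e' ∨ (z, y) = e' := step_eq_of_exit hyz hy hz
  have hbz : Relation.ReflTransGen (fun a c ↦ (a, c) ∈ bAugSteps H O (F \ {e})) b z := hby.tail hyz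
  have hby' : Relation.ReflTransGen (fun a c ↦ (a, c) ∈ bAugSteps H O (F \ {e'})) b y :=
    bAugChain_mono hsub hy
  intro p hp
  rcases hor with h | h
  · -- `e' = (y, z)`
    rw [← h] at hp
    rcases hp with rfl | rfl
    · exact Or.inr hby'
    · exact Or.inl hbz
  · -- `e' = (z, y)`
    rw [← h] at hp
    rcases hp with rfl | rfl
    · exact Or.inl hbz
    · exact Or.inr hby'

/-- **Nestedness of the `b`-sides of two needed edges.** -/
theorem side_subset_or_subset {F : Set (V × V)} {e e' : V × V} {b b' : V}
    (hconn : Relation.ReflTransGen (fun a c ↦ (a, c) ∈ bAugSteps H O F) b b')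
    (he : ¬ Relation.ReflTransGen (fun a c ↦ (a, c) ∈ bAugSteps H O (F \ {e})) b b')
    (he' : ¬ Relation.ReflTransGen (fun a c ↦ (a, c) ∈ bAugSteps H O (F \ {e'})) b b') :
    {v | Relation.ReflTransGen (fun a c ↦ (a, c) ∈ bAugSteps H O (F \ {e})) b v} ⊆
        {v | Relation.ReflTransGen (fun a c ↦ (a, c) ∈ bAugSteps H O (F \ {e'})) b v} ∨
      {v | Relation.ReflTransGen (fun a c ↦ (a, c) ∈ bAugSteps H O (F \ {e'})) b v} ⊆
        {v | Relation.ReflTransGen (fun a c ↦ (a, c) ∈ bAugSteps H O (F \ {e})) b v} := by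
  by_contra hcon
  rw [not_or] at hcon
  obtain ⟨⟨v, hv, hv'⟩, ⟨u, hu, hu'⟩⟩ := And.intro (not_subset.1 hcon.1) (not_subset.1 hcon.2)
  simp only [mem_setOf_eq] at hv hv' hu hu'
  -- both endpoints of `e'` and of `e` lie in the union `T` of the two sides
  let T : Set V := {p | Relation.ReflTransGen (fun a c ↦ (a, c) ∈ bAugSteps H O (F \ {e})) b p ∨
    Relation.ReflTransGen (fun a c ↦ (a, c) ∈ bAugSteps H O (F \ {e'})) b p}
  have hT' : ∀ p, (p = e'.1 ∨ p = e'.2) → p ∈ T := endpoints_mem_union hv hv'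
  have hT : ∀ p, (p = e.1 ∨ p = e.2) → p ∈ T := fun p hp ↦ (endpoints_mem_union hu hu' p hp).symm
  -- exit from `T` along the full chain
  have hbT : b ∈ T := Or.inl Relation.ReflTransGen.refl
  have hb'T : b' ∉ T := fun h ↦ h.elim he he'
  obtain ⟨y, z, hy, hz, hyz, -⟩ := bAugChain_exists_step_out (P := T) hconn hbT hb'T
  rcases hy with hy | hy
  · rcases step_eq_of_exit hyz hy (fun h ↦ hz (Or.inl h)) with h | h
    · exact hz (hT z (Or.inr (by rw [← h])))
    · exact hz (hT z (Or.inl (by rw [← h])))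
  · rcases step_eq_of_exit hyz hy (fun h ↦ hz (Or.inr h)) with h | h
    · exact hz (hT' z (Or.inr (by rw [← h])))
    · exact hz (hT' z (Or.inl (by rw [← h])))

/-- **The three-edge exclusion, sorted form**: for needed edges `f₁ ≠ f₂`, `f₃ ≠ f₂` with sides
`S_{f₁} ⊆ S_{f₂} ⊆ S_{f₃}`, the locales of `f₁` and `f₃` are not joined by an open path of `O`. -/
theorem not_joined_of_sides_sorted {F : Set (V × V)} {f₁ f₂ f₃ : V × V} {b b' : V}
    (hconn : Relation.ReflTransGen (fun a c ↦ (a, c) ∈ bAugSteps H O F) b b')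
    (hf₁ : ¬ Relation.ReflTransGen (fun a c ↦ (a, c) ∈ bAugSteps H O (F \ {f₁})) b b')
    (hf₂ : ¬ Relation.ReflTransGen (fun a c ↦ (a, c) ∈ bAugSteps H O (F \ {f₂})) b b')
    (hf₃ : ¬ Relation.ReflTransGen (fun a c ↦ (a, c) ∈ bAugSteps H O (F \ {f₃})) b b')
    (h₁₂ : f₁ ≠ f₂) (h₃₂ : f₃ ≠ f₂)
    (hS₁₂ : {v | Relation.ReflTransGen (fun a c ↦ (a, c) ∈ bAugSteps H O (F \ {f₁})) b v} ⊆
      {v | Relation.ReflTransGen (fun a c ↦ (a, c) ∈ bAugSteps H O (F \ {f₂})) b v})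
    (hS₂₃ : {v | Relation.ReflTransGen (fun a c ↦ (a, c) ∈ bAugSteps H O (F \ {f₂})) b v} ⊆
      {v | Relation.ReflTransGen (fun a c ↦ (a, c) ∈ bAugSteps H O (F \ {f₃})) b v}) :
    ¬ PathIn H O f₁.2 f₃.2 := by
  intro hp
  -- both endpoints of `f₁` are in `S_{f₂}`
  obtain ⟨y, z, hy, hz, hyz, -⟩ := bAugChain_exists_step_out
    (P := {v | Relation.ReflTransGen (fun a c ↦ (a, c) ∈ bAugSteps H O (F \ {f₁})) b v}) hconn
    Relation.ReflTransGen.refl hf₁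
  simp only [mem_setOf_eq] at hy hz
  have hor := step_eq_of_exit hyz hy hz
  have hy₂ : Relation.ReflTransGen (fun a c ↦ (a, c) ∈ bAugSteps H O (F \ {f₂})) b y := hS₁₂ hy
  have hz₂ : Relation.ReflTransGen (fun a c ↦ (a, c) ∈ bAugSteps H O (F \ {f₂})) b z :=
    hy₂.tail (step_mem_diff_of_needed hconn hf₁ hf₂ h₁₂ hyz hor)
  have h₁ : Relation.ReflTransGen (fun a c ↦ (a, c) ∈ bAugSteps H O (F \ {f₂})) b f₁.2 := by
    rcases hor with h | h
    · rw [← h]; exact hz₂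
    · rw [← h]; exact hy₂
  -- both endpoints of `f₃` are outside `S_{f₂}`
  obtain ⟨y', z', hy', hz', hyz', -⟩ := bAugChain_exists_step_out
    (P := {v | Relation.ReflTransGen (fun a c ↦ (a, c) ∈ bAugSteps H O (F \ {f₃})) b v}) hconn
    Relation.ReflTransGen.refl hf₃
  simp only [mem_setOf_eq] at hy' hz'
  have hor' := step_eq_of_exit hyz' hy' hz'
  have hz'₂ : ¬ Relation.ReflTransGen (fun a c ↦ (a, c) ∈ bAugSteps H O (F \ {f₂})) b z' :=
    fun h ↦ hz' (hS₂₃ h)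
  have hy'₂ : ¬ Relation.ReflTransGen (fun a c ↦ (a, c) ∈ bAugSteps H O (F \ {f₂})) b y' :=
    fun h ↦ hz'₂ (h.tail (step_mem_diff_of_needed hconn hf₃ hf₂ h₃₂ hyz' hor'))
  have h₃ : ¬ Relation.ReflTransGen (fun a c ↦ (a, c) ∈ bAugSteps H O (F \ {f₂})) b f₃.2 := by
    rcases hor' with h | h
    · rw [← h]; exact hz'₂
    · rw [← h]; exact hy'₂
  exact h₃ ((bAugChain_iff_of_pathIn (F \ {f₂}) hp).1 h₁)

/-- **No open cluster of `O` contains the locales of three distinct needed virtual edges.**  (So the map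
"edge ↦ open cluster of its locale" is at most two-to-one on a minimal re-connecting family: the BK structure of the
`𝔄`-error.) -/
theorem not_three_locales_joined {F : Set (V × V)} {e₁ e₂ e₃ : V × V} {b b' : V}
    (hconn : Relation.ReflTransGen (fun a c ↦ (a, c) ∈ bAugSteps H O F) b b')
    (he₁ : ¬ Relation.ReflTransGen (fun a c ↦ (a, c) ∈ bAugSteps H O (F \ {e₁})) b b')
    (he₂ : ¬ Relation.ReflTransGen (fun a c ↦ (a, c) ∈ bAugSteps H O (F \ {e₂})) b b')
    (he₃ : ¬ Relation.ReflTransGen (fun a c ↦ (a, c) ∈ bAugSteps H O (F \ {e₃})) b b')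
    (h₁₂ : e₁ ≠ e₂) (h₂₃ : e₂ ≠ e₃) (h₁₃ : e₁ ≠ e₃)
    (hp₁₂ : PathIn H O e₁.2 e₂.2)
    (hp₂₃ : PathIn H O e₂.2 e₃.2) : False := by
  have hp₁₃ := hp₁₂.trans hp₂₃
  have n₁₂ := side_subset_or_subset hconn he₁ he₂
  have n₂₃ := side_subset_or_subset hconn he₂ he₃
  have n₁₃ := side_subset_or_subset hconn he₁ he₃
  -- sort the three sides and apply the sorted form to the outer pair
  rcases n₁₂ with h12 | h21 <;> rcases n₂₃ with h23 | h32 <;> rcases n₁₃ with h13 | h31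
  · exact not_joined_of_sides_sorted hconn he₁ he₂ he₃ h₁₂ h₂₃.symm h12 h23 hp₁₃
  · exact not_joined_of_sides_sorted hconn he₁ he₂ he₃ h₁₂ h₂₃.symm h12 h23 hp₁₃
  · exact not_joined_of_sides_sorted hconn he₁ he₃ he₂ h₁₃ h₂₃ h13 h32 hp₁₂
  · exact not_joined_of_sides_sorted hconn he₃ he₁ he₂ h₁₃.symm h₁₂.symm h31 h12 hp₂₃.symm
  · exact not_joined_of_sides_sorted hconn he₂ he₁ he₃ h₁₂.symm h₁₃.symm h21 h13 hp₂₃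
  · exact not_joined_of_sides_sorted hconn he₂ he₃ he₁ h₂₃ h₁₃ h23 h31 hp₁₂.symm
  · exact not_joined_of_sides_sorted hconn he₃ he₂ he₁ h₂₃.symm h₁₂ h32 h21 hp₁₃.symm
  · exact not_joined_of_sides_sorted hconn he₃ he₂ he₁ h₂₃.symm h₁₂ h32 h21 hp₁₃.symm


end NeckBridge

/-- **No real cluster contains the locales of three distinct needed virtual edges (registered helper, anchor of this
module on the crux item; generic closed form of `NeckBridge.not_three_locales_joined`).**  For any simple graph `H` on
`V`, region `O`, family `F` of virtual edges and crossings `b, b'` chained over `F`: if each of three pairwise distinct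
edges `e₁, e₂, e₃` is needed (`b, b'` not chained over `F ∖ {eᵢ}`), then `e₁.2, e₂.2, e₃.2` are not all joined by
`H`-paths of `O`. -/
theorem bridge_not_three_locales_joined : ∀ (V : Type) (H : SimpleGraph V) (O : Set V) (F : Set (V × V)) (e₁ e₂ e₃ : V × V) (b b' : V), Relation.ReflTransGen (fun a c ↦ (a, c) ∈ NeckBridge.bAugSteps H O F) b b' → ¬ Relation.ReflTransGen (fun a c ↦ (a, c) ∈ NeckBridge.bAugSteps H O (F \ {e₁})) b b' → ¬ Relation.ReflTransGen (fun a c ↦ (a, c) ∈ NeckBridge.bAugSteps H O (F \ {e₂})) b b' → ¬ Relation.ReflTransGen (fun a c ↦ (a, c) ∈ NeckBridge.bAugSteps H O (F \ {e₃})) b b' → e₁ ≠ e₂ → e₂ ≠ e₃ → e₁ ≠ e₃ → ¬ (PathIn H O e₁.2 e₂.2 ∧ PathIn H O e₂.2 e₃.2) :=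
  fun _ _ _ _ _ _ _ _ _ hconn he₁ he₂ he₃ h₁₂ h₂₃ h₁₃ ⟨hp₁₂, hp₂₃⟩ ↦
    NeckBridge.not_three_locales_joined hconn he₁ he₂ he₃ h₁₂ h₂₃ h₁₃ hp₁₂ hp₂₃

end Summit.CriticalPhenomena.CardyFormulaZ2.Cruxes.NestingRigidity.PinchResampling
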